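import Summits.ResolutionOfSingularities.ResolutionOfSingularities.Theorems.RadicialJungCleanModelsStubExtendParameter
import Literature.AlgebraicGeometry.Resolution.GiraudFunctionNormalForm
import Literature.AlgebraicGeometry.Resolution.GiraudLogJacobianIdeal
import Mathlib.RingTheory.TensorProduct.Basic
import Mathlib.AlgebraicGeometry.Morphisms.FiniteType
import HarnessLib

/-!
# Route `RadicialJung`, crux `CleanModels` (stmt-15917): Giraud's normal form OFF the critical set
# (T2 brick B7, the `F-96`-free branch of the read-off)

Support file (OURS) for PROGRAMME-clean-dim2 / T2 (`HOME/L/res-L0-w81-pv-2/g5/T2-ARCHITECTURE.md`,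
brick B7; skeleton `T2Skeleton.lean`, stub `stub_readOff`, left branch), line `via-clean-models` of
crux `DescentPerfectToAll` (stmt-0549). Nothing here is a statement of Hironaka's manuscript.

Giraud (Bull. SMF 111 (1983), p. 114): "Observons que `df` ne s'annule pas au point `ξ` si, et
seulement si, on a (c-2) avec `r = 0`." In the derivation form of `E(f)` (`derivCriticalSet`):
at a point `ξ ∉ E(f)` some derivation of `𝒪_{X,ξ}` takes a unit value on `f`, hence `1 ⊗ df ≠ 0`
in `κ(ξ) ⊗ Ω_{𝒪_{X,ξ}/ℤ}`, i.e. the one-member family `(f)` is differentially free, and `f` is in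
Giraud's normal form of Prop. 1.5 (ii) with `r = 0`, `g = 0`, `u = f`
(`giraud15NormalFormAt_of_isDifferentiallyFree`). PROVED, for any regular local ring (the point
only needs a regular system of parameters):

* `one_tmul_D_ne_zero_of_derivation_apply_not_mem` — `D f ∉ 𝔪 ⇒ 1 ⊗ df ≠ 0`;
* `isDifferentiallyFree_snoc_zero_of_derivation_apply_not_mem` — hence `(f)` is differentially free;
* `giraud15NormalFormAt_of_not_derivJacobianIdeal_le` — `J(O, f) ⊄ 𝔪 ⇒` normal form at `O`;
* `giraud15NormalFormAt_of_not_mem_derivCriticalSet` — at a point `ξ ∉ E(f)` of a regular scheme.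

## References
* J. Giraud, Forme normale d'une fonction sur une surface de caractéristique positive, Bull. Soc.
  Math. France 111 (1983) 109–124: Prop. 1.5 and the remark p. 114. [Giraud1983]
-/

noncomputable section

set_option linter.dupNamespace false -- mandated namespace of this single-conjunct summit

open CategoryTheory AlgebraicGeometry TopologicalSpace IsLocalRing KaehlerDifferential
open Literature.AlgebraicGeometry.Resolution
open scoped TensorProduct

namespace Summit.ResolutionOfSingularities.ResolutionOfSingularities.Theorems.RadicialJung.CleanModels

universe u

/-! ## A derivation with a unit value makes `1 ⊗ df` non-zero -/

/-- If some derivation `D` of the local ring `O` has `D f ∉ 𝔪`, then `1 ⊗ df ≠ 0` in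
`κ ⊗_O Ω_{O/ℤ}` (apply the functional `κ ⊗ Ω → κ ⊗ κ → κ` induced by `D` and the residue map).
[cite: Giraud1983, Prop. 1.5 (remark p. 114)] -/
theorem one_tmul_D_ne_zero_of_derivation_apply_not_mem {O : Type u} [CommRing O] [IsLocalRing O]
    (D : Derivation ℤ O O) {f : O} (hf : D f ∉ maximalIdeal O) :
    ((1 : ResidueField O) ⊗ₜ[O] KaehlerDifferential.D ℤ O f : ResidueField O ⊗[O] Ω[O⁄ℤ]) ≠ 0 := by
  intro h0
  -- the functional `Ω → O → κ`
  let χ : Ω[O⁄ℤ] →ₗ[O] ResidueField O :=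
    (Algebra.linearMap O (ResidueField O)) ∘ₗ D.liftKaehlerDifferential
  have hχ : χ (KaehlerDifferential.D ℤ O f) = residue O (D f) := by
    change algebraMap O (ResidueField O) (D.liftKaehlerDifferential (KaehlerDifferential.D ℤ O f)) = _
    rw [Derivation.liftKaehlerDifferential_comp_D]
    rfl
  -- `κ ⊗ Ω → κ ⊗ κ → κ`
  let Ψ : ResidueField O ⊗[O] Ω[O⁄ℤ] →ₗ[O] ResidueField O :=
    (Algebra.TensorProduct.lmul' O (S := ResidueField O)).toLinearMap ∘ₗ LinearMap.lTensor _ χ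
  have hΨ : Ψ ((1 : ResidueField O) ⊗ₜ[O] KaehlerDifferential.D ℤ O f) = residue O (D f) := by
    change Algebra.TensorProduct.lmul' O (LinearMap.lTensor _ χ (1 ⊗ₜ _)) = _
    rw [LinearMap.lTensor_tmul, Algebra.TensorProduct.lmul'_apply_tmul, one_mul, hχ]
  have : residue O (D f) = 0 := by rw [← hΨ, h0, map_zero]
  exact hf ((residue_eq_zero_iff _).mp this)

/-- Hence the one-member family `(f)` (as `Fin.snoc` of the empty family, the shape used by
`Giraud15NormalFormAt` with `r = 0`) is differentially free. [cite: Giraud1983, 1.1 and Prop. 1.5] -/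
theorem isDifferentiallyFree_snoc_zero_of_derivation_apply_not_mem {O : Type u} [CommRing O]
    [IsLocalRing O] (D : Derivation ℤ O O) {f : O} (hf : D f ∉ maximalIdeal O) (t₀ : Fin 0 → O) :
    IsDifferentiallyFree (Fin.snoc t₀ f : Fin (0 + 1) → O) := by
  rw [IsDifferentiallyFree, Fintype.linearIndependent_iff]
  intro g hg i
  have hi0 : ∀ j : Fin (0 + 1), j = 0 := fun j => Fin.ext (by have := j.2; omega)
  have hval : (Fin.snoc t₀ f : Fin (0 + 1) → O) 0 = f := Fin.snoc_last _ _
  rw [Fin.sum_univ_succ, Finset.univ_eq_empty, Finset.sum_empty, add_zero, hval] at hg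
  have h0 : g 0 = 0 := by
    rcases smul_eq_zero.mp hg with h | h
    · exact h
    · exact absurd h (one_tmul_D_ne_zero_of_derivation_apply_not_mem D hf)
  rw [hi0 i]
  exact h0

/-! ## Giraud's normal form with `r = 0` -/

/-- **`J(O, f) ⊄ 𝔪 ⇒ f` is in Giraud's normal form (`r = 0`)** at the regular local ring `O`.
[cite: Giraud1983, Prop. 1.5 (remark p. 114)] -/
theorem giraud15NormalFormAt_of_not_derivJacobianIdeal_le {p : ℕ} (hp : p ≠ 0) {O : Type u}
    [CommRing O] [IsRegularLocalRing O] (f : O) (hf : ¬ derivJacobianIdeal O f ≤ maximalIdeal O) :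
    Giraud15NormalFormAt p f := by
  -- some derivation with a unit value
  have hD : ∃ D : Derivation ℤ O O, D f ∉ maximalIdeal O := by
    by_contra h
    push Not at h
    apply hf
    rw [derivJacobianIdeal, Ideal.span_le, Set.range_subset_iff]
    exact h
  obtain ⟨D, hDf⟩ := hD
  -- a regular system of parameters
  obtain ⟨t, ht⟩ := exists_regularSystemOfParameters (R := O)
  have hd : ringKrullDim O = ((maximalIdeal O).spanFinrank : WithBot ℕ∞) :=
    (IsRegularLocalRing.spanFinrank_maximalIdeal).symm
  exact giraud15NormalFormAt_of_isDifferentiallyFree hp t ht hd f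
    (isDifferentiallyFree_snoc_zero_of_derivation_apply_not_mem D hDf _)

/-- **At a point `ξ ∉ E(f)` of a regular scheme, the germ of `f` is in Giraud's normal form
(`r = 0`).** [cite: Giraud1983, Prop. 1.5 (remark p. 114)] -/
theorem giraud15NormalFormAt_of_not_mem_derivCriticalSet {p : ℕ} (hp : p ≠ 0) (X : Scheme.{u})
    (hreg : Scheme.IsRegular X) (f : Γ(X, ⊤)) {ξ : X} (hξ : ξ ∉ derivCriticalSet X f) :
    Giraud15NormalFormAt p (X.presheaf.germ ⊤ ξ trivial f) := by
  haveI : IsRegularLocalRing (X.presheaf.stalk ξ) := hreg ξ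
  exact giraud15NormalFormAt_of_not_derivJacobianIdeal_le hp _ hξ

end Summit.ResolutionOfSingularities.ResolutionOfSingularities.Theorems.RadicialJung.CleanModels

end
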